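import Literature.MathematicalPhysics.KineticTheory.ReyBelletThomas2002Scaling
import Literature.MathematicalPhysics.KineticTheory.ReyBelletThomas2002Control
import HarnessLib

/-!
# Rey-Bellet–Thomas 2002, Theorem 3.3: the limiting chain does not dissipate only at critical points

Trunk T-KINETIC (Literature/MathematicalPhysics/KineticTheory). Inline step towards Theorem 3.3 /
Theorem 3.10 for the named fact `ReyBelletThomas2002_thm21` (provefact unit; regime `k₁ = k₂ = k`,
where the printed scaling argument is sound). The deterministic heart of the proof of Theorem 3.3
(p. 16): "Suppose that `∫₀^τ r̃² dt = 0`, then `r̃ ≡ 0` … from the third equation `p̃₁ = p̃ₙ = 0`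
… `q̃₁` constant … `q̃₂` constant … Inductively one concludes that `r̃ = 0` implies `p̃ = 0` and
`∇Ṽ = 0` and thus the initial condition is a critical point", here for the LIMITING equations
(21)/(22) (forces `a k |y|^{k-2} y`, which are injective, so the right-inverse step is exact) and
for any noise-free integral solution:

* `rbForceOf fU fV N i q`, `rbDriftOf fU fV γ Λ N c_p c_r` — the chain force / reservoir drift built
  from EXPLICIT one-body and bond forces (`rbDriftGen P = rbDriftOf U' V'`, `rbDriftGen_eq_rbDriftOf`);
* `RBGrowth.limitForce_*` — `a k |y|^{k-2} y` is continuous, odd-signed, strictly monotone, and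
  satisfies Euler's identity `y · F(y) = k · a|y|^k`;
* `eqOn_zero_of_forall_integral_eq_zero` — a continuous function all of whose primitives vanish
  on `[0, T]` vanishes there;
* `limit_cascade` — **for a continuous solution of `y = y(0) + ∫₀ D(y)` on `[0, T]` (`T > 0`,
  `Λ ≠ 0`, `fV` injective) with `∫₀ᵀ (r_L² + r_R²) = 0`: `p(0) = 0`, all forces vanish at `q(0)`,
  and `r(0) = 0`** (induction over the sites from the left reservoir);
* `eq_zero_of_forall_rbForceOf_limit_eq_zero` — **maximum principle**: with the limiting forces,
  if all chain forces vanish then `q = 0` (at a maximal site the pinning force is not compensated).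

## References

* L. Rey-Bellet, L. E. Thomas, Comm. Math. Phys. **225** (2002) 305–329, Thm 3.3 (proof, p. 16),
  §3.1 eqs. (21)–(25).
* P. Carmona, Stoch. Proc. Appl. **117** (2007) 1076–1092, Lemma 5.1 (the same cascade for
  Langevin baths).
-/

noncomputable section

open MeasureTheory Filter Topology Set intervalIntegral
open scoped NNReal

namespace Literature.MathematicalPhysics.KineticTheory.HeatConduction

open Literature.Analysis.ODE Literature.MathematicalPhysics.KineticTheory

variable {N : ℕ}

/-! ### Chain forces and reservoir drifts from explicit force functions -/

/-- The **chain force on site `i` from explicit forces**: `fU(q_i) + [0<i] fV(q_i - q_{i-1}) -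
[i+1<N] fV(q_{i+1} - q_i)` (the closed form of `∂Φ/∂q_i` with `U' ↦ fU`, `V' ↦ fV`).
[cite: ReyBelletThomas2002, §3.1 eq. (21)] -/
def rbForceOf (fU fV : ℝ → ℝ) (N : ℕ) (i : Fin N) (q : Fin N → ℝ) : ℝ :=
  fU (q i) + (if h : 0 < i.val then fV (q i - q ⟨i.val - 1, by omega⟩) else 0) -
    (if h : i.val + 1 < N then fV (q ⟨i.val + 1, h⟩ - q i) else 0)

/-- The **reservoir drift from explicit forces** with reservoir coefficients `c_p, c_r`:
`q̇ = p`, `ṗ = -F(q) - c_p Λᵀ r`, `ṙ = -c_r γ r + Λ p` (eqs. (20)–(22)).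
[cite: ReyBelletThomas2002, §3.1 eqs. (20)–(22)] -/
def rbDriftOf (fU fV : ℝ → ℝ) (γ Λ : ℝ) (N : ℕ) (c_p c_r : ℝ) (x : RBPhaseSpace N) : RBPhaseSpace N :=
  ((x.1.2, fun i => -rbForceOf fU fV N i x.1.1 -
      c_p * Λ * ((if i.val = 0 then x.2.1 else 0) + (if i.val = N - 1 then x.2.2 else 0))),
    (-(c_r * γ * x.2.1) + Λ * ∑ i : Fin N, (if i.val = 0 then x.1.2 i else 0),
      -(c_r * γ * x.2.2) + Λ * ∑ i : Fin N, (if i.val = N - 1 then x.1.2 i else 0)))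

/-- The rescaled drift of a chain is the drift built from the derivatives of its potentials.
[cite: ReyBelletThomas2002, §3.1 eq. (20)] -/
theorem OscillatorChain.rbDriftGen_eq_rbDriftOf (P : OscillatorChain) (Λ : ℝ) (N : ℕ) (c_p c_r : ℝ) :
    P.rbDriftGen Λ N c_p c_r = rbDriftOf (deriv P.U) (deriv P.V) P.γ Λ N c_p c_r := by
  funext x
  simp only [OscillatorChain.rbDriftGen, rbDriftOf, rbForceOf, OscillatorChain.dPotential_eq_closed]

/-- The drift from explicit forces is continuous for continuous forces. [folklore] -/
theorem continuous_rbDriftOf {fU fV : ℝ → ℝ} (hfU : Continuous fU) (hfV : Continuous fV)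
    (γ Λ : ℝ) (N : ℕ) (c_p c_r : ℝ) : Continuous (rbDriftOf fU fV γ Λ N c_p c_r) := by
  unfold rbDriftOf rbForceOf
  refine ((continuous_snd.comp continuous_fst).prodMk (continuous_pi fun i => ?_)).prodMk
    ((Continuous.add ?_ ?_).prodMk (Continuous.add ?_ ?_))
  · refine (Continuous.sub (Continuous.add ?_ ?_) ?_).neg.sub ?_
    · exact hfU.comp ((continuous_apply i).comp (continuous_fst.comp continuous_fst))
    · split_ifs
      · exact hfV.comp (((continuous_apply i).comp (continuous_fst.comp continuous_fst)).sub
          ((continuous_apply _).comp (continuous_fst.comp continuous_fst)))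
      · exact continuous_const
    · split_ifs
      · exact hfV.comp (((continuous_apply _).comp (continuous_fst.comp continuous_fst)).sub
          ((continuous_apply i).comp (continuous_fst.comp continuous_fst)))
      · exact continuous_const
    · refine continuous_const.mul (Continuous.add ?_ ?_) <;> split_ifs
      · exact continuous_fst.comp continuous_snd
      · exact continuous_const
      · exact continuous_snd.comp continuous_snd
      · exact continuous_const
  · exact (continuous_const.mul (continuous_fst.comp continuous_snd)).neg
  · refine continuous_const.mul (continuous_finsetSum _ fun i _ => ?_)
    split_ifs
    · exact (continuous_apply i).comp (continuous_snd.comp continuous_fst)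
    · exact continuous_const
  · exact (continuous_const.mul (continuous_snd.comp continuous_snd)).neg
  · refine continuous_const.mul (continuous_finsetSum _ fun i _ => ?_)
    split_ifs
    · exact (continuous_apply i).comp (continuous_snd.comp continuous_fst)
    · exact continuous_const

/-! ### The limiting force -/

namespace RBGrowth

/-- `F_∞(0) = 0`. [folklore] -/
@[simp] theorem limitForce_zero (a k : ℝ) : limitForce a k 0 = 0 := by simp [limitForce]

/-- `|F_∞(y)| = a k |y|^{k-1}` in the form `|y|^{k-2} |y| = |y|^{k-1}` (`k ≠ 1`). [folklore] -/
theorem abs_rpow_sub_two_mul_abs {k : ℝ} (hk : k - 1 ≠ 0) (y : ℝ) : |y| ^ (k - 2) * |y| = |y| ^ (k - 1) := by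
  have : k - 1 = (k - 2) + 1 := by ring
  rw [this, Real.rpow_add_one' (abs_nonneg y) (by rw [← this]; exact hk)]

/-- **Euler's identity for the limiting force**: `y · (a k |y|^{k-2} y) = k · a |y|^k` (`k ≥ 2`).
[folklore] -/
theorem mul_limitForce (a : ℝ) {k : ℝ} (hk : 2 ≤ k) (y : ℝ) : y * limitForce a k y = k * limitPot a k y := by
  unfold limitForce limitPot
  have h1 : k - 1 ≠ 0 := by linarith
  have hy2 : y * y = |y| * |y| := (abs_mul_abs_self y).symm
  have hk' : |y| ^ k = |y| ^ (k - 1) * |y| := by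
    have : k = (k - 1) + 1 := by ring
    conv_lhs => rw [this]
    exact Real.rpow_add_one' (abs_nonneg y) (by linarith)
  calc y * (a * k * |y| ^ (k - 2) * y) = a * k * (|y| ^ (k - 2) * (y * y)) := by ring
    _ = a * k * (|y| ^ (k - 2) * |y| * |y|) := by rw [hy2]; ring
    _ = k * (a * |y| ^ k) := by rw [abs_rpow_sub_two_mul_abs h1, hk']; ring

/-- The limiting force is continuous (`k ≥ 2`). [folklore] -/
theorem continuous_limitForce (a : ℝ) {k : ℝ} (hk : 2 ≤ k) : Continuous (limitForce a k) := by
  unfold limitForce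
  exact ((continuous_const.mul (continuous_abs.rpow_const fun _ => Or.inr (by linarith))).mul
    continuous_id)

/-- The limiting force has the sign of its argument: `F_∞(y) > 0` for `y > 0` (`a > 0`, `k ≥ 2`).
[folklore] -/
theorem limitForce_pos {a k : ℝ} (ha : 0 < a) (hk : 2 ≤ k) {y : ℝ} (hy : 0 < y) : 0 < limitForce a k y := by
  unfold limitForce
  have : 0 < |y| ^ (k - 2) := Real.rpow_pos_of_pos (abs_pos.2 hy.ne') _
  have hk0 : 0 < k := by linarith
  positivity

/-- The limiting force is odd. [folklore] -/
theorem limitForce_neg (a k y : ℝ) : limitForce a k (-y) = -limitForce a k y := by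
  simp [limitForce, abs_neg]

/-- `F_∞(y) < 0` for `y < 0` (`a > 0`, `k ≥ 2`). [folklore] -/
theorem limitForce_neg_of_neg {a k : ℝ} (ha : 0 < a) (hk : 2 ≤ k) {y : ℝ} (hy : y < 0) :
    limitForce a k y < 0 := by
  have := limitForce_pos ha hk (neg_pos.2 hy)
  rw [limitForce_neg] at this
  linarith

/-- `|F_∞(y)| = a k |y|^{k-1}` (`a ≥ 0`, `k ≥ 2`). [folklore] -/
theorem abs_limitForce {a k : ℝ} (ha : 0 ≤ a) (hk : 2 ≤ k) (y : ℝ) : |limitForce a k y| = a * k * |y| ^ (k - 1) := by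
  unfold limitForce
  rw [abs_mul, abs_mul, abs_mul, abs_of_nonneg ha, abs_of_nonneg (by linarith : (0 : ℝ) ≤ k),
    abs_of_nonneg (Real.rpow_nonneg (abs_nonneg y) _), mul_assoc (a * k),
    abs_rpow_sub_two_mul_abs (by linarith) y]

/-- **The limiting force is strictly increasing** (`a > 0`, `k ≥ 2`): it has the sign of its
argument and `|F_∞(y)| = a k |y|^{k-1}` is strictly increasing in `|y|`. [folklore] -/
theorem limitForce_strictMono {a k : ℝ} (ha : 0 < a) (hk : 2 ≤ k) : StrictMono (limitForce a k) := by
  intro y₁ y₂ h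
  have hk1 : 0 < k - 1 := by linarith
  -- strict monotonicity of `t ↦ a k t^{k-1}` on `[0, ∞)`
  have hmono : ∀ {s t : ℝ}, 0 ≤ s → s < t → a * k * s ^ (k - 1) < a * k * t ^ (k - 1) := by
    intro s t hs hst
    have := Real.rpow_lt_rpow hs hst hk1
    have hak : 0 < a * k := mul_pos ha (by linarith)
    exact mul_lt_mul_of_pos_left this hak
  rcases lt_or_ge y₁ 0 with h1 | h1
  · rcases le_or_gt y₂ 0 with h2 | h2
    · -- both nonpositive: `F = -|F|`, `|y₁| > |y₂|`
      have e1 : limitForce a k y₁ = -(a * k * |y₁| ^ (k - 1)) := by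
        have := abs_limitForce ha.le hk y₁
        have hneg := limitForce_neg_of_neg ha hk h1
        rw [abs_of_neg hneg] at this; linarith
      have e2 : limitForce a k y₂ = -(a * k * |y₂| ^ (k - 1)) := by
        rcases eq_or_lt_of_le h2 with h2' | h2'
        · rw [h2', limitForce_zero, abs_zero, Real.zero_rpow hk1.ne']; ring
        · have := abs_limitForce ha.le hk y₂
          have hneg := limitForce_neg_of_neg ha hk h2'
          rw [abs_of_neg hneg] at this; linarith
      rw [e1, e2, neg_lt_neg_iff]
      exact hmono (abs_nonneg y₂) (by rw [abs_of_nonpos h2, abs_of_neg h1]; linarith)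
    · exact (limitForce_neg_of_neg ha hk h1).trans (limitForce_pos ha hk h2)
  · -- `0 ≤ y₁ < y₂`
    have h2 : 0 < y₂ := h1.trans_lt h
    have e1 : limitForce a k y₁ = a * k * |y₁| ^ (k - 1) := by
      rcases eq_or_lt_of_le h1 with h1' | h1'
      · rw [← h1', limitForce_zero, abs_zero, Real.zero_rpow hk1.ne']; ring
      · have := abs_limitForce ha.le hk y₁
        rwa [abs_of_pos (limitForce_pos ha hk h1')] at this
    have e2 : limitForce a k y₂ = a * k * |y₂| ^ (k - 1) := by
      have := abs_limitForce ha.le hk y₂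
      rwa [abs_of_pos (limitForce_pos ha hk h2)] at this
    rw [e1, e2]
    exact hmono (abs_nonneg y₁) (by rw [abs_of_nonneg h1, abs_of_pos h2]; exact h)

/-- The limiting force is injective (`a > 0`, `k ≥ 2`). [folklore] -/
theorem limitForce_injective {a k : ℝ} (ha : 0 < a) (hk : 2 ≤ k) : Function.Injective (limitForce a k) :=
  (limitForce_strictMono ha hk).injective

/-- The limiting potential is nonnegative (`a ≥ 0`). [folklore] -/
theorem limitPot_nonneg {a : ℝ} (ha : 0 ≤ a) (k y : ℝ) : 0 ≤ limitPot a k y :=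
  mul_nonneg ha (Real.rpow_nonneg (abs_nonneg y) k)

/-- The limiting potential vanishes only at `0` (`a > 0`, `k > 0`). [folklore] -/
theorem limitPot_eq_zero_iff {a k : ℝ} (ha : 0 < a) (hk : 0 < k) (y : ℝ) : limitPot a k y = 0 ↔ y = 0 := by
  unfold limitPot
  rw [mul_eq_zero, Real.rpow_eq_zero_iff_of_nonneg (abs_nonneg y), abs_eq_zero]
  constructor
  · rintro (h | ⟨h, -⟩)
    · exact absurd h ha.ne'
    · exact h
  · intro h; exact Or.inr ⟨h, hk.ne'⟩

end RBGrowth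

/-! ### A continuous function with vanishing primitives vanishes -/

/-- **A continuous function all of whose primitives vanish on `[0, T]` (`T > 0`) vanishes on
`[0, T]`**: the primitive is differentiable with derivative the function, and is locally constant
on `(0, T)`; the endpoints follow by continuity. [folklore] -/
theorem eqOn_zero_of_forall_integral_eq_zero {g : ℝ → ℝ} (hg : Continuous g) {T : ℝ} (hT : 0 < T)
    (h : ∀ t ∈ Icc 0 T, ∫ s in (0 : ℝ)..t, g s = 0) : ∀ t ∈ Icc 0 T, g t = 0 := by
  have hΦ : ∀ t, HasDerivAt (fun u => ∫ s in (0 : ℝ)..u, g s) (g t) t := fun t =>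
    (hg.integral_hasStrictDerivAt 0 t).hasDerivAt
  have hint : ∀ t ∈ Ioo 0 T, g t = 0 := by
    intro t ht
    have hev : (fun u => ∫ s in (0 : ℝ)..u, g s) =ᶠ[𝓝 t] fun _ => (0 : ℝ) :=
      Filter.eventuallyEq_of_mem (Ioo_mem_nhds ht.1 ht.2) fun u hu => h u ⟨hu.1.le, hu.2.le⟩
    have h0 : HasDerivAt (fun u => ∫ s in (0 : ℝ)..u, g s) 0 t :=
      (hasDerivAt_const t (0 : ℝ)).congr_of_eventuallyEq hev
    exact (hΦ t).unique h0
  intro t ht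
  have hclosed : IsClosed {t : ℝ | g t = 0} := isClosed_eq hg continuous_const
  have hsub : Icc 0 T ⊆ {t | g t = 0} := by
    rw [← closure_Ioo hT.ne]
    exact closure_minimal hint hclosed
  exact hsub ht

/-- **Vanishing dissipation integral forces `r ≡ 0`**: if `∫₀ᵀ (r_L² + r_R²) = 0` for a continuous
path (`T > 0`), then `r_L = r_R = 0` on `[0, T]`. [cite: ReyBelletThomas2002, Thm 3.3 (proof)] -/
theorem reservoir_eq_zero_of_integral_sq_eq_zero {y : ℝ → RBPhaseSpace N} (hyc : Continuous y)
    {T : ℝ} (hT : 0 < T) (h : ∫ s in (0 : ℝ)..T, ((y s).2.1 ^ 2 + (y s).2.2 ^ 2) = 0) :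
    ∀ t ∈ Icc 0 T, (y t).2.1 = 0 ∧ (y t).2.2 = 0 := by
  set f : ℝ → ℝ := fun s => (y s).2.1 ^ 2 + (y s).2.2 ^ 2 with hf
  have hfc : Continuous f := ((continuous_fst.comp (continuous_snd.comp hyc)).pow 2).add
    ((continuous_snd.comp (continuous_snd.comp hyc)).pow 2)
  have hf0 : ∀ s, 0 ≤ f s := fun s => by positivity
  -- if `f t₀ > 0` somewhere on `[0, T]`, the integral would be positive
  have hzero : ∀ t ∈ Icc 0 T, f t = 0 := by
    by_contra hcon
    simp only [not_forall, exists_prop] at hcon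
    obtain ⟨t₀, ht₀, hft₀⟩ := hcon
    have hpos : 0 < f t₀ := lt_of_le_of_ne (hf0 t₀) (Ne.symm hft₀)
    have := intervalIntegral.integral_lt_integral_of_continuousOn_of_le_of_exists_lt hT
      (continuousOn_const (c := (0 : ℝ))) hfc.continuousOn (fun s _ => hf0 s) ⟨t₀, ht₀, hpos⟩
    rw [intervalIntegral.integral_const, smul_zero] at this
    exact absurd h (ne_of_gt this)
  intro t ht
  have h1 := hzero t ht
  simp only [hf] at h1
  constructor <;> nlinarith [sq_nonneg (y t).2.1, sq_nonneg (y t).2.2]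

/-! ### The cascade: `r ≡ 0` forces a critical point -/

/-- **The cascade of Theorem 3.3 for the limiting equations.** Let `y` be a continuous solution
of `y(t) = y(0) + ∫₀ᵗ D(y)` on `[0, T]` (`T > 0`) for the reservoir drift `D = rbDriftOf fU fV γ Λ N c_p c_r`
with `Λ ≠ 0`, `fU, fV` continuous and `fV` INJECTIVE, and suppose `r_L = r_R = 0` on `[0, T]`.
Then every momentum vanishes and every chain force vanishes along the path:
`r ≡ 0 ⇒ p₀ ≡ 0 ⇒ q₀` constant `⇒ F₀(q) ≡ 0 ⇒ fV(q₁ - q₀)` constant `⇒ q₁` constant `⇒ p₁ ≡ 0 ⇒ …`.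
[cite: ReyBelletThomas2002, Thm 3.3 (proof)] -/
theorem limit_cascade {fU fV : ℝ → ℝ} (hfU : Continuous fU) (hfV : Continuous fV)
    (hinj : Function.Injective fV) {γ Λ : ℝ} (hΛ : Λ ≠ 0) (hN : 0 < N) {c_p c_r : ℝ}
    {y : ℝ → RBPhaseSpace N} (hyc : Continuous y) {T : ℝ} (hT : 0 < T)
    (hy : IsIntegralSolutionOn (rbDriftOf fU fV γ Λ N c_p c_r) (fun _ => y 0) y T)
    (hr : ∀ t ∈ Icc 0 T, (y t).2.1 = 0 ∧ (y t).2.2 = 0) :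
    (∀ i, ∀ t ∈ Icc 0 T, (y t).1.2 i = 0) ∧ (∀ i, ∀ t ∈ Icc 0 T, rbForceOf fU fV N i (y t).1.1 = 0) := by
  set D := rbDriftOf fU fV γ Λ N c_p c_r with hD
  have hDc : Continuous fun s => D (y s) := (continuous_rbDriftOf hfU hfV γ Λ N c_p c_r).comp hyc
  -- the integral equation, componentwise
  have hq : ∀ t ∈ Icc 0 T, ∀ i, (y t).1.1 i = (y 0).1.1 i + ∫ s in (0 : ℝ)..t, (y s).1.2 i := by
    intro t ht i
    obtain ⟨e11, -, -, -⟩ := integral_rbPhaseSpace_apply hDc 0 t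
    have := congrArg (fun v : RBPhaseSpace N => v.1.1 i) (hy t ht)
    simp only [Prod.fst_add, Pi.add_apply] at this
    rw [this, e11]
    rfl
  have hp : ∀ t ∈ Icc 0 T, ∀ i, (y t).1.2 i = (y 0).1.2 i +
      ∫ s in (0 : ℝ)..t, (-rbForceOf fU fV N i (y s).1.1 -
        c_p * Λ * ((if i.val = 0 then (y s).2.1 else 0) + (if i.val = N - 1 then (y s).2.2 else 0))) := by
    intro t ht i
    obtain ⟨-, e12, -, -⟩ := integral_rbPhaseSpace_apply hDc 0 t
    have := congrArg (fun v : RBPhaseSpace N => v.1.2 i) (hy t ht)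
    simp only [Prod.fst_add, Prod.snd_add, Pi.add_apply] at this
    rw [this, e12]
    rfl
  have hrL : ∀ t ∈ Icc 0 T, (y t).2.1 = (y 0).2.1 +
      ∫ s in (0 : ℝ)..t, (-(c_r * γ * (y s).2.1) + Λ * ∑ i : Fin N, (if i.val = 0 then (y s).1.2 i else 0)) := by
    intro t ht
    obtain ⟨-, -, e21, -⟩ := integral_rbPhaseSpace_apply hDc 0 t
    have := congrArg (fun v : RBPhaseSpace N => v.2.1) (hy t ht)
    simp only [Prod.snd_add, Prod.fst_add] at this
    rw [this, e21]
    rfl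
  -- continuity of the components
  have hpc : ∀ i, Continuous fun s => (y s).1.2 i := fun i =>
    (continuous_apply i).comp (continuous_snd.comp (continuous_fst.comp hyc))
  have hqc : ∀ i, Continuous fun s => (y s).1.1 i := fun i =>
    (continuous_apply i).comp (continuous_fst.comp (continuous_fst.comp hyc))
  have hFc : ∀ i, Continuous fun s => rbForceOf fU fV N i (y s).1.1 := fun i => by
    unfold rbForceOf
    refine (Continuous.add (hfU.comp (hqc i)) ?_).sub ?_
    · split_ifs
      · exact hfV.comp ((hqc i).sub (hqc _))
      · exact continuous_const
    · split_ifs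
      · exact hfV.comp ((hqc _).sub (hqc i))
      · exact continuous_const
  -- site `0`
  set i₀ : Fin N := ⟨0, hN⟩ with hi₀
  -- Step A: `p₀ ≡ 0`
  have hp0 : ∀ t ∈ Icc 0 T, (y t).1.2 i₀ = 0 := by
    have hint : ∀ t ∈ Icc 0 T, ∫ s in (0 : ℝ)..t, (y s).1.2 i₀ = 0 := by
      intro t ht
      have h1 := hrL t ht
      rw [(hr t ht).1, (hr 0 ⟨le_rfl, hT.le⟩).1, zero_add] at h1
      have hcongr : ∫ s in (0 : ℝ)..t, (-(c_r * γ * (y s).2.1) +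
          Λ * ∑ i : Fin N, (if i.val = 0 then (y s).1.2 i else 0)) = ∫ s in (0 : ℝ)..t, Λ * (y s).1.2 i₀ := by
        refine intervalIntegral.integral_congr fun s hs => ?_
        rw [uIcc_of_le ht.1] at hs
        have hs' : s ∈ Icc 0 T := ⟨hs.1, hs.2.trans ht.2⟩
        simp only [(hr s hs').1, mul_zero, neg_zero, zero_add]
        congr 1
        rw [Finset.sum_eq_single_of_mem i₀ (Finset.mem_univ _)]
        · simp [hi₀]
        · intro b _ hb
          rw [if_neg]
          exact fun hb0 => hb (Fin.ext hb0)
      rw [hcongr, intervalIntegral.integral_const_mul] at h1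
      have := mul_eq_zero.1 h1.symm
      rcases this with h | h
      · exact absurd h hΛ
      · exact h
    exact eqOn_zero_of_forall_integral_eq_zero (hpc i₀) hT hint
  -- the force step: `p_m ≡ 0 ⇒ F_m(q) ≡ 0`
  have hforce : ∀ (i : Fin N), (∀ t ∈ Icc 0 T, (y t).1.2 i = 0) →
      ∀ t ∈ Icc 0 T, rbForceOf fU fV N i (y t).1.1 = 0 := by
    intro i hpi
    have hint : ∀ t ∈ Icc 0 T, ∫ s in (0 : ℝ)..t, rbForceOf fU fV N i (y s).1.1 = 0 := by
      intro t ht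
      have h1 := hp t ht i
      rw [hpi t ht, hpi 0 ⟨le_rfl, hT.le⟩, zero_add] at h1
      have hcongr : ∫ s in (0 : ℝ)..t, (-rbForceOf fU fV N i (y s).1.1 -
          c_p * Λ * ((if i.val = 0 then (y s).2.1 else 0) + (if i.val = N - 1 then (y s).2.2 else 0))) =
          ∫ s in (0 : ℝ)..t, -rbForceOf fU fV N i (y s).1.1 := by
        refine intervalIntegral.integral_congr fun s hs => ?_
        rw [uIcc_of_le ht.1] at hs
        have hs' : s ∈ Icc 0 T := ⟨hs.1, hs.2.trans ht.2⟩
        simp only [(hr s hs').1, (hr s hs').2]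
        split_ifs <;> ring
      rw [hcongr, intervalIntegral.integral_neg] at h1
      linarith
    exact eqOn_zero_of_forall_integral_eq_zero (hFc i) hT hint
  -- the position step: `p_i ≡ 0 ⇒ q_i` constant
  have hconst : ∀ (i : Fin N), (∀ t ∈ Icc 0 T, (y t).1.2 i = 0) →
      ∀ t ∈ Icc 0 T, (y t).1.1 i = (y 0).1.1 i := by
    intro i hpi t ht
    rw [hq t ht i]
    have : ∫ s in (0 : ℝ)..t, (y s).1.2 i = ∫ s in (0 : ℝ)..t, (0 : ℝ) := by
      refine intervalIntegral.integral_congr fun s hs => ?_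
      rw [uIcc_of_le ht.1] at hs
      exact hpi s ⟨hs.1, hs.2.trans ht.2⟩
    rw [this, intervalIntegral.integral_zero, add_zero]
  -- the reverse step: `q_i` constant `⇒ p_i ≡ 0`
  have hmom : ∀ (i : Fin N), (∀ t ∈ Icc 0 T, (y t).1.1 i = (y 0).1.1 i) →
      ∀ t ∈ Icc 0 T, (y t).1.2 i = 0 := by
    intro i hqi
    have hint : ∀ t ∈ Icc 0 T, ∫ s in (0 : ℝ)..t, (y s).1.2 i = 0 := by
      intro t ht
      have h1 := hq t ht i
      rw [hqi t ht] at h1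
      linarith
    exact eqOn_zero_of_forall_integral_eq_zero (hpc i) hT hint
  -- induction over the sites
  have hmain : ∀ m : ℕ, ∀ j : ℕ, j ≤ m → ∀ hj : j < N, ∀ t ∈ Icc 0 T, (y t).1.2 ⟨j, hj⟩ = 0 := by
    intro m
    induction m with
    | zero =>
      intro j hj hjN
      have : (⟨j, hjN⟩ : Fin N) = i₀ := Fin.ext (by simp [hi₀]; omega)
      rw [this]
      exact hp0
    | succ m ih =>
      intro j hj hjN
      rcases Nat.lt_or_ge j (m + 1) with hjm | hjm
      · exact ih j (by omega) hjN
      · -- `j = m + 1`: use sites `m` and `m - 1`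
        have hjm' : j = m + 1 := le_antisymm hj hjm
        subst hjm'
        have hmN : m < N := by omega
        have hpm := ih m le_rfl hmN
        have hqm := hconst ⟨m, hmN⟩ hpm
        have hFm := hforce ⟨m, hmN⟩ hpm
        -- positions of `m - 1` are constant too (if `m > 0`)
        have hqm1 : ∀ (h : 0 < m), ∀ t ∈ Icc 0 T, (y t).1.1 ⟨m - 1, by omega⟩ = (y 0).1.1 ⟨m - 1, by omega⟩ :=
          fun h => hconst ⟨m - 1, by omega⟩ (ih (m - 1) (by omega) (by omega))
        -- from `F_m(q(t)) = 0 = F_m(q(0))`: `fV(q_{m+1}(t) - q_m(0)) = fV(q_{m+1}(0) - q_m(0))`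
        have hqm1c : ∀ t ∈ Icc 0 T, (y t).1.1 ⟨m + 1, hjN⟩ = (y 0).1.1 ⟨m + 1, hjN⟩ := by
          intro t ht
          have e1 := hFm t ht
          have e0 := hFm 0 ⟨le_rfl, hT.le⟩
          simp only [rbForceOf] at e1 e0
          rw [dif_pos (show (⟨m, hmN⟩ : Fin N).val + 1 < N from hjN)] at e1 e0
          have hleft : (if h : 0 < (⟨m, hmN⟩ : Fin N).val then
              fV ((y t).1.1 ⟨m, hmN⟩ - (y t).1.1 ⟨(⟨m, hmN⟩ : Fin N).val - 1, by simp; omega⟩) else 0) =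
              (if h : 0 < (⟨m, hmN⟩ : Fin N).val then
              fV ((y 0).1.1 ⟨m, hmN⟩ - (y 0).1.1 ⟨(⟨m, hmN⟩ : Fin N).val - 1, by simp; omega⟩) else 0) := by
            by_cases h0 : 0 < m
            · rw [dif_pos (show 0 < (⟨m, hmN⟩ : Fin N).val from h0), dif_pos (show 0 < (⟨m, hmN⟩ : Fin N).val from h0),
                hqm t ht]
              have := hqm1 h0 t ht
              rw [this]
            · rw [dif_neg (show ¬ 0 < (⟨m, hmN⟩ : Fin N).val from h0), dif_neg (show ¬ 0 < (⟨m, hmN⟩ : Fin N).val from h0)]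
          rw [hleft, hqm t ht] at e1
          have hval : (⟨(⟨m, hmN⟩ : Fin N).val + 1, hjN⟩ : Fin N) = ⟨m + 1, hjN⟩ := rfl
          rw [hval] at e1 e0
          have heq : fV ((y t).1.1 ⟨m + 1, hjN⟩ - (y 0).1.1 ⟨m, hmN⟩) =
              fV ((y 0).1.1 ⟨m + 1, hjN⟩ - (y 0).1.1 ⟨m, hmN⟩) := by linarith
          have := hinj heq
          linarith
        exact hmom ⟨m + 1, hjN⟩ hqm1c
  have hall : ∀ i : Fin N, ∀ t ∈ Icc 0 T, (y t).1.2 i = 0 := fun i =>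
    hmain i.val i.val le_rfl i.isLt
  exact ⟨hall, fun i => hforce i (hall i)⟩

/-! ### The maximum principle for the limiting forces -/

/-- **Maximum principle**: with the limiting forces `fU = a₁ k|y|^{k-2}y`, `fV = a₂ k|y|^{k-2}y`
(`a₁, a₂ > 0`, `k ≥ 2`), if every chain force `F_i(q)` vanishes then `q = 0`: at a site where `q` is
maximal and positive, the pinning force is positive and the bond forces from the (lower)
neighbours do not compensate it; symmetrically for the minimum. [folklore] -/
theorem eq_zero_of_forall_rbForceOf_limit_eq_zero {a₁ a₂ k : ℝ} (ha₁ : 0 < a₁) (ha₂ : 0 < a₂)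
    (hk : 2 ≤ k) (q : Fin N → ℝ)
    (h : ∀ i, rbForceOf (RBGrowth.limitForce a₁ k) (RBGrowth.limitForce a₂ k) N i q = 0) : q = 0 := by
  -- the one-sided statement: all `q_i ≤ 0`
  have upper : ∀ (q : Fin N → ℝ),
      (∀ i, rbForceOf (RBGrowth.limitForce a₁ k) (RBGrowth.limitForce a₂ k) N i q = 0) → ∀ i, q i ≤ 0 := by
    intro q h i
    by_contra hcon
    rw [not_le] at hcon
    obtain ⟨j, -, hj⟩ := Finset.exists_max_image Finset.univ q ⟨i, Finset.mem_univ _⟩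
    have hjpos : 0 < q j := hcon.trans_le (hj i (Finset.mem_univ _))
    have hmono := (RBGrowth.limitForce_strictMono ha₂ hk).monotone
    have hF := h j
    simp only [rbForceOf] at hF
    have h1 : 0 < RBGrowth.limitForce a₁ k (q j) := RBGrowth.limitForce_pos ha₁ hk hjpos
    have h2 : 0 ≤ (if h : 0 < j.val then RBGrowth.limitForce a₂ k (q j - q ⟨j.val - 1, by omega⟩) else 0) := by
      split_ifs with hj0
      · have : 0 ≤ q j - q ⟨j.val - 1, by omega⟩ := sub_nonneg.2 (hj _ (Finset.mem_univ _))
        have := hmono this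
        rwa [RBGrowth.limitForce_zero] at this
      · exact le_rfl
    have h3 : (if h : j.val + 1 < N then RBGrowth.limitForce a₂ k (q ⟨j.val + 1, h⟩ - q j) else 0) ≤ 0 := by
      split_ifs with hj1
      · have : q ⟨j.val + 1, hj1⟩ - q j ≤ 0 := sub_nonpos.2 (hj _ (Finset.mem_univ _))
        have := hmono this
        rwa [RBGrowth.limitForce_zero] at this
      · exact le_rfl
    linarith
  have hup := upper q h
  -- apply to `-q` (the forces are odd)
  have hneg : ∀ i, rbForceOf (RBGrowth.limitForce a₁ k) (RBGrowth.limitForce a₂ k) N i (-q) = 0 := by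
    intro i
    have hF := h i
    simp only [rbForceOf, Pi.neg_apply] at hF ⊢
    have e1 : ∀ u v : ℝ, -u - -v = -(u - v) := fun u v => by ring
    simp only [e1, RBGrowth.limitForce_neg]
    have e2 : ∀ (c : Prop) [Decidable c] (u : ℝ), (if c then -u else 0) = -(if c then u else 0) := by
      intro c _ u; split_ifs <;> simp
    rw [show (if h : 0 < i.val then -RBGrowth.limitForce a₂ k (q i - q ⟨i.val - 1, by omega⟩) else 0) =
        -(if h : 0 < i.val then RBGrowth.limitForce a₂ k (q i - q ⟨i.val - 1, by omega⟩) else 0) by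
          split_ifs <;> simp,
      show (if h : i.val + 1 < N then -RBGrowth.limitForce a₂ k (q ⟨i.val + 1, h⟩ - q i) else 0) =
        -(if h : i.val + 1 < N then RBGrowth.limitForce a₂ k (q ⟨i.val + 1, h⟩ - q i) else 0) by
          split_ifs <;> simp]
    linarith
  have hdown := upper (-q) hneg
  funext i
  have a := hup i
  have b := hdown i
  simp only [Pi.neg_apply, neg_nonpos] at b
  exact le_antisymm a b

/-- **The conclusion of Theorem 3.3's contradiction argument for the limiting system**: for a
continuous noise-free solution on `[0, T]` (`T > 0`) of the limiting reservoir dynamics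
(forces `a₁ k|y|^{k-2}y`, `a₂ k|y|^{k-2}y`, `a₁, a₂ > 0`, `k ≥ 2`, `Λ ≠ 0`, `N ≥ 1`) whose
dissipation integral `∫₀ᵀ (r_L² + r_R²)` vanishes, the initial point is the trivial critical point:
`q(0) = 0`, `p(0) = 0`, `r(0) = 0`. [cite: ReyBelletThomas2002, Thm 3.3 (proof)] -/
theorem limit_initial_eq_zero {a₁ a₂ k : ℝ} (ha₁ : 0 < a₁) (ha₂ : 0 < a₂) (hk : 2 ≤ k)
    {γ Λ : ℝ} (hΛ : Λ ≠ 0) (hN : 0 < N) {c_p c_r : ℝ} {y : ℝ → RBPhaseSpace N} (hyc : Continuous y)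
    {T : ℝ} (hT : 0 < T)
    (hy : IsIntegralSolutionOn (rbDriftOf (RBGrowth.limitForce a₁ k) (RBGrowth.limitForce a₂ k) γ Λ N c_p c_r)
      (fun _ => y 0) y T)
    (hdiss : ∫ s in (0 : ℝ)..T, ((y s).2.1 ^ 2 + (y s).2.2 ^ 2) = 0) :
    (y 0).1.1 = 0 ∧ (y 0).1.2 = 0 ∧ (y 0).2 = 0 := by
  have hr := reservoir_eq_zero_of_integral_sq_eq_zero hyc hT hdiss
  obtain ⟨hp, hF⟩ := limit_cascade (RBGrowth.continuous_limitForce a₁ hk)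
    (RBGrowth.continuous_limitForce a₂ hk) (RBGrowth.limitForce_injective ha₂ hk) hΛ hN hyc hT hy hr
  have h0 : (0 : ℝ) ∈ Icc 0 T := ⟨le_rfl, hT.le⟩
  refine ⟨eq_zero_of_forall_rbForceOf_limit_eq_zero ha₁ ha₂ hk _ fun i => hF i 0 h0,
    funext fun i => hp i 0 h0, Prod.ext (hr 0 h0).1 (hr 0 h0).2⟩

end Literature.MathematicalPhysics.KineticTheory.HeatConduction

end
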